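import Mathlib
import HarnessLib
import HarnessLib.Audit
import Summits.AtomisticToContinuum.Statement
import Literature.MathematicalPhysics.QuantumManyBody.PeriodicBoseGas

/-!
Route: BECUvDepletionFloor

CLOSED (retired) 2026-08-15T13:41:05Z by operator:999:1257524 — reason: not-a-thesis: assembly does not conclude the sub-problem Statement — note: D-0027 §2.1 audit (human 2026-08-15: routes that do not decide the summit are removed): the assembly concludes `DepletionFloor`, not the sub-problem statement; a NEW conforming route may be opened from the same idea (generated `closes : … → _root_.BoseEinsteinCondensation`).. The file is kept as the record of this route; refuted decls are indexed as negative knowledge (`ledger negatives`).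

# Route BECUvDepletionFloor — energy sees the ultraviolet half of the depletion — a
thermodynamic-limit floor 1 − λ_max/N ≥ c√(ρa³) capping the conjunct's constant

MILESTONE ROUTE, NEGATIVE SIDE (pattern of ABC/RadicalCensus and AnomalousDissipation/SteadySweep):
it suffices to show X = DepletionFloor —
for every bounded repulsive finite-range radial v with scattering length a > 0 there are ρ₀, c > 0
such that for all 0 < ρ < ρ₀ and all large N
the conjunct's own quantity obeys condensateNumber v N (N/ρ)^{1/3} ≤ N(1 − c√(ρa³)): the ground
state of the dilute gas in the Dirichlet box is NEVER
asymptotically completely condensed; the constant c(ρ) of HasGroundStateBEC is ≤ 1 − c√(ρa³). X does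
not decide the conjunct (BEC allows any c > 0)
and says so; it is the first thermodynamic-limit statement about the spectrum of γ of the
interacting continuum ground state, an upper bound on the
condensate obtained from ENERGY, and it makes the soft/hard split of barrier
EnergyAsymptoticsWithoutCondensation quantitative. Realises card
uv-depletion-floor-tl (spine); the target statement was first written in-pool as item E2 of card
suto-cycle-identity-autopsy.
X is reached from two "energy sees the ultraviolet" cruxes about δ-near-minimisers Ψ of the
Dirichlet energy — UvShellFloor (the plane-wave shell
K₁√(ρa) ≤ |p| ≤ 2K₁√(ρa) carries ≥ (c/K₁)√(ρa³)N particles: Bogoliubov's k⁻⁴ tail, seen by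
second-order box coercivity) and NoUvFragment (no single
direction in the span of that shell carries more than (C/K₁²)√(ρa³)N) — through an elementary
occupation dichotomy (√occupation is a seminorm in the
mode; Bessel for the shell family; Cauchy–Schwarz), with the order-√(ρa³) energy UPPER bound in the
thermodynamic limit as the explicit fact-crux both consume.
Lean: `∀ v : ℝ → ENNReal,
Literature.MathematicalPhysics.QuantumManyBody.BoseGas.IsRepulsiveFiniteRange v → (∫⁻ x :
Literature.MathematicalPhysics.QuantumManyBody.BoseGas.Space, v ‖x‖) ≠ ⊤ → (∃ C : ℝ, ∀ r, v r ≤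
ENNReal.ofReal C) → 0 < Literature.MathematicalPhysics.QuantumManyBody.BoseGas.scatteringLength v →
∃ ρ₀ c : ℝ, 0 < ρ₀ ∧ 0 < c ∧ ∀ ρ : ℝ, 0 < ρ → ρ < ρ₀ → ∀ᶠ N : ℕ in Filter.atTop,
Literature.MathematicalPhysics.QuantumManyBody.BoseGas.condensateNumber v N
(Literature.MathematicalPhysics.QuantumManyBody.BoseGas.sideLength ρ N) + ENNReal.ofReal (c *
Real.sqrt (ρ * (Literature.MathematicalPhysics.QuantumManyBody.BoseGas.scatteringLength v).toReal ^
3) * N) ≤ (N : ENNReal)`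

## Assembly
Elementary bookkeeping, PROVED sorry-free in the planner's Sketch.lean (theorem assembly_holds,
axioms propext/Classical.choice/Quot.sound): fix v and
the class hypotheses; LhyOrderUpperBound gives the upper bound U(v) (and E₀ ≠ ⊤ eventually);
UvShellFloor U(v) gives (c, K₀); NoUvFragment U(v) gives
(C, K₀'); choose K₁ := max(K₀, K₀', 2C/c), K₂ := 2K₁, ρ₀ := min of the three thresholds, c' :=
c/(2K₁) (then C/K₁² ≤ c'); for ρ < ρ₀ intersect the
three eventualities in N, take δ := min(δ_floor, δ_ceiling); for each δ-near-minimiser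
PlaneWaveDichotomy with S = (c/K₁)√(ρa³)N, A = (C/K₁²)√(ρa³)N
gives maxOccupation + c'√(ρa³)N ≤ N after one ℝ≥0∞ cancellation, and NearMinUpperBound turns it into
condensateNumber + c'√(ρa³)N ≤ N. The chain ends
in the route-local target (milestone pattern); it does not, and does not claim to, decide
Summit.AtomisticToContinuum.BoseEinsteinCondensation.

Rationale: WHY THIS LINE. Energy is blind only to SOFT modes: the ultraviolet half of Bogoliubov's momentum
distribution (|p| ≳ √(ρa), n_p → (8πρa)²/(4p⁴), Tan's tail) lives on
modes whose kinetic energy p² = K₁²ρa exceeds the interaction scale 8πρa once K₁ ≫ 5, and the shell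
[K₁,2K₁]√(ρa) is energetically STIFF — Bogoliubov
mass 4√(ρa³)N/K₁ times quasiparticle energy ≈ K₁²ρa grows like K₁ (ratio to the LHY energy
4π·4.81·ρa√(ρa³)N ≈ K₁/15) — so de-occupying it (deficit ≤ 2√(V_shell · slack/E_K)) or piling its
mass into one direction
(≤ 2 slack/E_K) is excluded already by ORDER-√(ρa³) two-sided energy control with NON-sharp
constants: the second-order lower bound in Fournais boxes
is PROVED in the tree (Literature…BoseGas.Fournais2020_thm21 = BrietzkeFournaisSolovej2020 Thm 6.1,
and Fournais2020_condensation_holds), the upper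
bound is ErdosSchleinYau2008 / YauYin2009 / BastiCenatiempoSchlein2021 (filed as crux
LhyOrderUpperBound, inlined as hypothesis of the two mechanism
cruxes so provers are never blocked on it). Imported areas: many-body variational localisation (LHY
programme: FournaisSolovej2020, Fournais2020,
arXiv:2603.20776), Bogoliubov quasi-free coercivity (BoccatoEtAl2019Acta for the GP analogue), and
plain Hilbert-space geometry for the passage
"shell occupations ⇒ λ_max" (no Jentzsch/Perron–Frobenius, no torus, no Parseval, no inner box — the
delta over the card, checked: Assembly is proved
sorry-free in the planner's Sketch.lean). No open BEC route (BECInfraredBound, BECPeriodicReduction,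
BECPinning, BECPalmLandscape, BECRenormGroup) has a
negative-side or ultraviolet item; the negatives index of the summit is empty.

RANKED CRUXES. #0 DepletionFloor (target) — for every bounded repulsive finite-range radial v (∫v <
∞ kept verbatim as in the tree's Fournais facts) with scatteringLength v > 0 there are ρ₀, c > 0
with: for all 0 < ρ < ρ₀, eventually in N, condensateNumber v N (sideLength ρ N) + c√(ρa³)N ≤ N (a =
(scatteringLength v).toReal). Card uv-depletion-floor-tl step (5), Dirichlet form, on the conjunct's
own quantity. (why it might fail: believed true (Bogoliubov: 1 − λ_max/N → (8/3√π)√(ρa³)); fails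
only if the Dirichlet ground state were completely condensed beyond Bogoliubov precision along a
subsequence — would refute Bogoliubov theory in the TL, not BEC.) [LSSY2005, BoccatoEtAl2019Acta,
PenroseOnsager1956, FournaisSolovej2020]
#2 LhyOrderUpperBound (crux) — FACT-FIRST CRUX (dependency of the mechanism; the plancard rule
"unproved named fact = first crux"): for every v of the class there are C, ρ₁ > 0 such that for 0 <
ρ < ρ₁, eventually in N, the DIRICHLET ground-state energy in the box of side (N/ρ)^{1/3} is ≤
4πρaN(1 + C√(ρa³)) — an order-√(ρa³) (Lee–Huang–Yang-order, constant free) upper bound at fixed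
density. Vendor as a Literature named fact from the printed thermodynamic-limit theorems + Robinson
localisation, or prove from an ESY/Bijl–Dingle–Jastrow trial state (the tree already proves LSSY Thm
2.4 and Fournais 2020 Thm 1.2 in full). [difficulty: L] (why it might fail: printed theorems bound
the TL energy density (YauYin2009 smooth v; BastiCenatiempoSchlein2021 v ∈ L³ ⊇ bounded); the
fixed-ρ finite Dirichlet-box form needs existence + boundary-condition independence of e₀(ρ)
(Robinson1971, LSSY2005 Ch. 2) — a corollary, not printed verbatim.) [ErdosSchleinYau2008,
YauYin2009, BastiCenatiempoSchlein2021, Robinson1971, LSSY2005, BrooksEtAl2026]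
#3 UvShellFloor (crux) — THE MECHANISM (card steps (2)–(4) merged into one thermodynamic-limit
statement; hardest item): for every v of the class, IF the order-√(ρa³) upper bound of
LhyOrderUpperBound holds for v, THEN there are c, K₀ > 0 such that for every K₁ ≥ K₀ there is ρ₀ > 0
with: for 0 < ρ < ρ₀, eventually in N, for some δ > 0, every Dirichlet trial state Ψ with energy ≤
E₀ + δ has a finite set F of box plane waves φ_k = L^{-3/2}e^{2πik·x/L}1_box, all with momenta
K₁√(ρa) ≤ |2πk/L| ≤ 2K₁√(ρa) (sup norm), whose occupations sum to ≥ (c/K₁)√(ρa³)N. Bogoliubov value: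
4√(ρa³)N/K₁ (n_p ≈ (8πρa)²/4p⁴ integrated over the shell), so c ≤ 4; the 1/K₁ law is Tan's k⁻⁴ tail.
[deps: LhyOrderUpperBound] [difficulty: XL] (why it might fail: needs the mode-resolved Bogoliubov
Hessian (keep Σ_shell E_k b†b in BFS/Fournais Thm 2.1) for box states with fluctuating particle
number + smooth-shell IMS localisation; constants must close: deficit ≤ V_shell/2 needs slack
C_sl√(ρa³)ρaN ≤ K₁√(ρa³)ρaN/4, i.e. K₀ ≳ 4C_sl.) [BrietzkeFournaisSolovej2020, Fournais2020,
FournaisSolovej2020, BoccatoEtAl2019Acta, BrenneckeCaporalettiSchlein2022, arXiv:2603.20776]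
#4 NoUvFragment (crux) — NO ULTRAVIOLET FRAGMENT (energy sees the UV from above, direction by
direction): for every v of the class, IF the order-√(ρa³) upper bound holds for v, THEN there are C,
K₀ > 0 such that for all K₀ ≤ K₁ < K₂ there is ρ₀ > 0 with: for 0 < ρ < ρ₀, eventually in N, for
some δ > 0, every δ-near-minimiser Ψ, every finite set F of box plane waves with momenta in
[K₁√(ρa), K₂√(ρa)] and every unit coefficient vector α: the occupation of the single mode Σ_k α_k
φ_k is ≤ (C/K₁²)√(ρa³)N. Truth expected far stronger (O(1): γ is diagonal in plane waves for the
torus ground state and each n_p ≤ C); the K₁⁻² law is what the kinetic price p² ≥ K₁²ρa of the shell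
buys from an order-√(ρa³) energy slack via n_u ≤ 2 max v_p² + 2 n^b(u). [deps: LhyOrderUpperBound]
[difficulty: L] (why it might fail: occupation of a hard mode u costs no kinetic energy by itself
(n_u picks up |⟨u,φ₀⟩|²N; Dirichlet walls leak O(N^{1/3}) into axis modes) and coherence ACROSS
boxes is not box-local: the proof must use the pairing structure (b-variables), i.e. the box
coercivity of UvShellFloor.) [BoccatoEtAl2019Acta, BrietzkeFournaisSolovej2020, Fournais2020,
LSSY2005]
#9 PlaneWaveDichotomy (support) — OCCUPATION DICHOTOMY (pure Hilbert-space geometry, provable now):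
for every N, L, every Dirichlet trial state Ψ, every finite set F of box plane waves and S, A ∈
[0,∞]: if the occupations of the φ_k, k ∈ F, sum to ≥ S and every unit combination Σ α_k φ_k has
occupation ≤ A, then maxOccupation N Ψ.ψ + S ≤ N + A. Proof: q(φ) = occupation is N∫dY|⟨φ,Ψ(·,Y)⟩|²,
so √q is a seminorm; split a unit φ = φ_S + φ_⊥ along span F; q(φ_S) ≤ ‖φ_S‖²A (homogeneity); Bessel
for the orthonormal family F ∪ {φ_⊥/‖φ_⊥‖} integrated over Y gives q(φ_⊥) ≤ ‖φ_⊥‖²(N − S);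
Cauchy–Schwarz (√(tA)+√((1−t)B))² ≤ A + B. Needs orthonormality of distinct box plane waves (∫₀ᴸ
e^{2πimx/L}dx = 0, m ≠ 0) and the L ≤ 0 / N = 0 degenerate cases (TrialState empty / everything 0).
[difficulty: provable-now] [LSSY2005, PenroseOnsager1956]
#9 NearMinUpperBound (support) — NEAR-MINIMISERS BOUND THE CONDENSATE NUMBER FROM ABOVE (mirror of
the library lemma le_condensateNumber, provable now): for all v, N, L, δ₀ > 0, m, b: if E₀(N,L) ≠ ⊤
and every trial state with energy ≤ E₀ + δ₀ has maxOccupation + b ≤ m, then condensateNumber v N L +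
b ≤ m. Proof: for each δ > 0 pick, by iInf_lt_iff with min δ δ₀ > 0 and E₀ ≠ ⊤, a trial state below
E₀ + min δ δ₀; iInf₂_le, then ENNReal.iSup_add over the nonempty index δ > 0. [difficulty:
provable-now] [LSSY2005]

TWO-LAYER PLAN. Foreseen glued splits (filed only after a crux closes or stalls with a census):
UvShellFloor ⇐ BoxShellCoercivity → ShellLocalisation → SlackBudget →
UvShellFloor, where BoxShellCoercivity = Fournais2020_thm21 with the shell's Σ_{k∈shell} E_k b_k†b_k
KEPT on the lower side (typed over the tree's
kinBoxN/attrBoxN/repBoxN/nPlusBoxN of PeriodicBoseGasBox/Sector), ShellLocalisation = smooth-cutoff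
IMS bound Σ_k h(p_kξ)n_k ≥ ∫du (box shell forms) −
C N/(K₁ℓ√(ρa)), SlackBudget = LhyOrderUpperBound − Σ_u box lower bounds ≤ C√(ρa³)ρaN. NoUvFragment ⇐
the same BoxShellCoercivity → a pairing-structure
lemma n_u ≤ 2 max_shell v_p² + 2⟨quasi-particle number in u⟩ → NoUvFragment. LhyOrderUpperBound ⇐
(TL energy density fact, vendored) → (Dirichlet
finite-box corollary via Robinson localisation). k ≤ 3 each, depth 1.

KILL CRITERIA. Refutation of DepletionFloor or UvShellFloor for some admissible bounded v (a
near-minimiser family with o(√(ρa³))N particles in every UV shell) refutes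
Bogoliubov's momentum distribution in the thermodynamic limit — close the route `refuted:<Decl>` and
hand the witness to barrier
EnergyAsymptoticsWithoutCondensation as a 3-D entry. Refutation of NoUvFragment alone (a UV fragment
compatible with LHY-order energy) kills the
Dirichlet-direct passage: pivot to the torus form (Jentzsch: λ_max = n₀ for the positive
translation-invariant ground state, then Bessel needs no
NoUvFragment) as a restate of the target on periodicGroundStateEnergy/condensateOccupation.
LhyOrderUpperBound cannot be refuted for the class (in
print); if its Dirichlet finite-box form is shown to need more than the class gives, restate with v
∈ C_c^∞. A proof elsewhere of complete condensation
c(ρ) → 1 in the TL would refute the target (and Bogoliubov theory) — not expected. DepletionFloor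
proved ⇒ milestone reached: close `superseded`/keep
theorems, append the evasions_known line to EnergyAsymptoticsWithoutCondensation, feed
suto-cycle-identity-autopsy (E2) and sum-rules-run-backwards.

NOT DECOMPOSED YET. The box-level coercivity lemma and the IMS shell localisation (layer-2 children
above); hard cores and general L¹ potentials (need FournaisSolovej2022 +
BastiEtAl2024 in place of the bounded-v inputs; the target is expected verbatim for them); the sharp
constant (c → 4(1−ε) per shell, total depletion
(8/3√π)√(ρa³) needs the SHARP LHY pair FournaisSolovej2020 + YauYin2009 and M → ∞); the
periodic/Jentzsch twin and any boundary-condition transfer;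
positive temperature; the corollary "c(ρ) ≤ 1 − c'√(ρa³)" as a separate decl (it is DepletionFloor
read through HasGroundStateBEC).

CHEAPEST FALSIFIER. (a) One-line Bogoliubov integral (done while drafting): shell mass
L³∫_{K₁√(ρa)}^{2K₁√(ρa)} (μ²/4p⁴)4πp²dp/(2π)³ with μ = 8πρa equals 4√(ρa³)N/K₁ > 0
and the stiffness ratio (shell mass 4√(ρa³)N/K₁ × E_K ≈ K₁²ρa)/(LHY energy 4π·(128/15√π)ρa√(ρa³)N ≈
60.4ρa√(ρa³)N) ≈ K₁/15 → ∞: the budget (deficit ≤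
V_shell/2 iff slack ≤ K₁ρa√(ρa³)N/4) closes for K₁ ≳ 4C_sl; had the UV
share been o(√(ρa³)) or the ratio bounded the line would be dead. (b) Refuter check of
NoUvFragment's necessity: exhibit, in the exactly solvable
quadratic Bogoliubov model on the torus, a state within o(√(ρa³))ρaN of the ground energy whose
shell block of γ has an eigenvalue ≥ ε√(ρa³)N — if
such a state exists WITH the pairing structure intact, NoUvFragment is not an energetic statement
and rank 4 must be re-mechanised (translation
averaging). (c) `lean check` of the whole frame: done, rc 0, Assembly proved.

NUMBERS. Bogoliubov (LSSY2005 App. A; BoccatoEtAl2019Acta Thm 1.1 for the GP analogue): μ = 8πρa (ħ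
= 2m = 1), healing length (8πρa)^{-1/2}, total depletion
(8/(3√π))√(ρa³) ≈ 1.505√(ρa³), UV tail n_p → (8πρa)²/(4p⁴) = 16π²ρ²a²/p⁴, shell [K₁,2K₁]√(ρa) mass
4√(ρa³)N/K₁ (UV asymptotics valid for K₁ ≫ √(8π) ≈ 5).
LHY: e₀ = 4πρ²a(1 + (128/(15√π))√(ρa³) + o(√(ρa³))), 128/(15√π) ≈ 4.81 (lower
FournaisSolovej2020/2022, upper YauYin2009, BastiCenatiempoSchlein2021,
BastiEtAl2024 hard spheres, third order BrooksEtAl2026). In-tree PROVED: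
LSSY2005_lowerBound_dirichlet/periodic/neumann (C = 64, C' = 1, exponent 1/17),
Fournais2020_thm21 (box ℓ = (K√(ρ_μ a))⁻¹, error C₀ρ_μ²aℓ³(ρ_μa³)^{1/2}), Fournais2020_condensation.
Items at open: 7 (1 target, 3 cruxes, 2 support, 1 assembly).

DEFINITION REQUESTS. None. Every constant exists:
Literature.MathematicalPhysics.QuantumManyBody.BoseGas.{IsRepulsiveFiniteRange, Space,
scatteringLength, sideLength,
TrialState, energy, groundStateEnergy, box, occupation, maxOccupation, condensateNumber}
(BoseEinsteinCondensation.lean, PeriodicBoseGas.lean); plane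
waves are inlined as in route BECInfraredBound. Cite facts wanted (to discharge LhyOrderUpperBound
by vendoring rather than proof): "fact: order-√(ρa³)
upper bound on the thermodynamic ground-state energy density, e₀(ρ) ≤ 4πρ²a(1 + C√(ρa³))"
[YauYin2009 Thm 1.1; BastiCenatiempoSchlein2021 Thm 1.1] and
"fact: existence and boundary-condition independence of e₀(ρ) for bounded finite-range v ≥ 0"
[Robinson1971; LSSY2005 Ch. 2 after (2.8)] — to be filed
with `ledger workitem add --kind cite` once the route id exists.

Novelty: Searches (2026-08-15, this seat; lit searchd down, arXiv/OpenAlex/S2 HTTP 429, so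
Crossref/zbMATH/frontier/galaxy): `lit search --source crossref
"second order upper bound ground state energy dilute Bose gas"` (10: doi:10.1017/fms.2021.66,
doi:10.1103/physreva.78.053627, YauYin2009,
doi:10.1007/s00220-026-05656-8 third order, …); `… "upper bound ground state energy dilute Bose gas
hard spheres"` (7: doi:10.1007/s00205-024-02049-w);
`… "quantum depletion condensate Bose gas rigorous momentum distribution"` (11, physics only); `…
"Tan contact rigorous Bose gas short-distance
one-particle density matrix"` (8, 1-D/physics only); `lit search --source zbmath "quantum depletion"
--year-from 2015` (12: BoccatoSeiringer2023
Neumann box = arXiv:2205.15284; rest off-topic); zbmath "condensate depletion Bose-Einstein rigorous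
Gross-Pitaevskii" (0); `lit frontier
AtomisticToContinuum --since 2022` (30: arXiv:2603.20776, arXiv:2510.20493, arXiv:2605.06844,
BrooksEtAl2026, AiM 2026 free-energy upper bound — no
depletion floor); `lit bridges AtomisticToContinuum --cross any` (no Bose-gas bridge); `lit galaxy
search "quantum depletion" --star all` (24: physics
textbooks/reviews only, e.g. cond-mat/0305138). Plus the card's two refuter audits (zbMATH 'lower
bound quantum depletion thermodynamic limit': 0;
BBCS, Rademacher arXiv:2410.13576, NNRT/COSS higher-order GP: all sub-thermodynamic).
Nearest prior art found: BoccatoEtAl2019Acta (doi:10.4310/acta.2019.v222.n2.a1; depletion and n_p in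
the  [refs: 10.1017/fms.2021.66, 10.1103/physreva.78.053627, 10.1007/s00220-026-05656-8, 10.1007/s00205-024-02049-w, 10.4310/acta.2019.v222.n2.a1, 2205.15284, 2603.20776, 2510.20493, 2605.06844, 2410.13576, 2011.00309, 1901.00539, 1904.06164, doi:10.1017/fms.2021.66, doi:10.1103/physreva.78.053627, doi:10.1007/s00220-026-05656-8, doi:10.1007/s00205-024-02049-w, doi:10.4310/acta.2019.v222.n2.a1, YauYin2009, Bo]

Barriers (technique_class: uv-locality negative-side second-order-coercivity): - technique_class: uv-locality negative-side second-order-coercivity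
- Literature.Barriers.AtomisticToContinuum.EnergyAsymptoticsWithoutCondensation: REFINED, not evaded
— the barrier says energy to the available orders cannot certify condensation (Lieb–Liniger witness:
Bogoliubov energy right to two orders, no condensate); this line proves the complementary positive
half: energy to order √(ρa³) DOES pin the ultraviolet occupations (|p| ≥ K₀√(ρa)) from below and
above, hence certifies NON-condensation of a definite fraction; the 1-D witness is consistent (there
too de/dγ fixes the contact/UV tail while the infrared decides condensation).
- Literature.Barriers.AtomisticToContinuum.KineticGapLengthScales: used inside its scope — all
coercivity happens in Fournais boxes ℓ = (K√(ρa))⁻¹ below the healing length where the gap arguments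
are theorems (Fournais2020_thm21 proved in tree); the thermodynamic limit enters only through
locality of a short-distance observable and an energy budget, never through a gap at scale L.
- Literature.Barriers.AtomisticToContinuum.BogoliubovPerturbationInfrared: irrelevant by design —
the shell sits at |p| ≥ K₀√(ρa), the infrared-divergent corrections to Bogoliubov live at p → 0; no
expansion around the Bogoliubov state is summed.
- Literature.Barriers.AtomisticToContinuum.CasimirBoxGeneralizedCondensation: not met — the target
is an UPPER bound on the largest eigenvalue in the cubic box (N/ρ)^{1/3} of the conjunct;
generalized condensation would onl

History (route lifecycle, newest last):
- 2026-08-15T13:41:05Z · CLOSED retired — not-a-thesis: assembly does not conclude the sub-problem Statement (operator:999:1257524)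

sub-problem: BoseEinsteinCondensation · status: closed(retired) · opened planner-plancard-AtomisticToContinuum-BoseEin-d2fb9b48-0 2026-08-15T11:48:32Z · rev 1 · ledger route-AtomisticToContinuum-BECUvDepletionFloor
GENERATED by the gate from the ledger (D-0016/17). Provers cite these decls: `theorem foo : Summit.AtomisticToContinuum.BoseEinsteinCondensation.Theses.BECUvDepletionFloor.<Decl> := …` in Summits/AtomisticToContinuum/BoseEinsteinCondensation/Theorems/<Name>.lean.
-/

namespace Summit.AtomisticToContinuum.BoseEinsteinCondensation.Theses.BECUvDepletionFloor

open scoped BigOperators Topology Manifold Classical MeasureTheory ProbabilityTheory Matrix InnerProductSpace ComplexConjugate ContinuousMap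
open Filter Set Function TopologicalSpace MeasureTheory

attribute [summit_statement] _root_.BoseEinsteinCondensation

/-- item stmt-AtomisticToContinuum-6593 · target · rank 0 · closed · moot by None · by planner
why it might fail: believed true (Bogoliubov: 1 − λ_max/N → (8/3√π)√(ρa³)); fails only if the Dirichlet ground state were completely condensed beyond Bogoliubov precision along a subsequence — would refute Bogoliubov theory in the TL, not BEC.
sources: LSSY2005, BoccatoEtAl2019Acta, PenroseOnsager1956, FournaisSolovej2020
[target] for every bounded repulsive finite-range radial v (∫v < ∞ kept verbatim as in the tree's
Fournais facts) with scatteringLength v > 0 there are ρ₀, c > 0 with: for all 0 < ρ < ρ₀, eventually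
in N, condensateNumber v N (sideLength ρ N) + c√(ρa³)N ≤ N (a = (scatteringLength v).toReal). Card
uv-depletion-floor-tl step (5), Dirichlet form, on the conjunct's own quantity. -/
@[route_item "route-AtomisticToContinuum-BECUvDepletionFloor"]
def DepletionFloor : Prop :=
  ∀ v : ℝ → ENNReal, Literature.MathematicalPhysics.QuantumManyBody.BoseGas.IsRepulsiveFiniteRange v → (∫⁻ x : Literature.MathematicalPhysics.QuantumManyBody.BoseGas.Space, v ‖x‖) ≠ ⊤ → (∃ C : ℝ, ∀ r, v r ≤ ENNReal.ofReal C) → 0 < Literature.MathematicalPhysics.QuantumManyBody.BoseGas.scatteringLength v → ∃ ρ₀ c : ℝ, 0 < ρ₀ ∧ 0 < c ∧ ∀ ρ : ℝ, 0 < ρ → ρ < ρ₀ → ∀ᶠ N : ℕ in Filter.atTop, Literature.MathematicalPhysics.QuantumManyBody.BoseGas.condensateNumber v N (Literature.MathematicalPhysics.QuantumManyBody.BoseGas.sideLength ρ N) + ENNReal.ofReal (c * Real.sqrt (ρ * (Literature.MathematicalPhysics.QuantumManyBody.BoseGas.scatteringLength v).toReal ^ 3) * N) ≤ (N : ENNR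eal)

/-- item stmt-AtomisticToContinuum-6594 · crux · rank 2 · closed · moot by None · by planner
why it might fail: printed theorems bound the TL energy density (YauYin2009 smooth v; BastiCenatiempoSchlein2021 v ∈ L³ ⊇ bounded); the fixed-ρ finite Dirichlet-box form needs existence + boundary-condition independence of e₀(ρ) (Robinson1971, LSSY2005 Ch. 2) — a corollary, not printed verbatim.
sources: ErdosSchleinYau2008, YauYin2009, BastiCenatiempoSchlein2021, Robinson1971, LSSY2005, BrooksEtAl2026
[crux] FACT-FIRST CRUX (dependency of the mechanism; the plancard rule "unproved named fact = first
crux"): for every v of the class there are C, ρ₁ > 0 such that for 0 < ρ < ρ₁, eventually in N, the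
DIRICHLET ground-state energy in the box of side (N/ρ)^{1/3} is ≤ 4πρaN(1 + C√(ρa³)) — an
order-√(ρa³) (Lee–Huang–Yang-order, constant free) upper bound at fixed density. Vendor as a
Literature named fact from the printed thermodynamic-limit theorems + Robinson localisation, or
prove from an ESY/Bijl–Dingle–Jastrow trial state (the tree already proves LSSY Thm 2.4 and Fournais
2020 Thm 1.2 in full). [difficulty: L] -/
@[route_item "route-AtomisticToContinuum-BECUvDepletionFloor"]
def LhyOrderUpperBound : Prop :=
  ∀ v : ℝ → ENNReal, Literature.MathematicalPhysics.QuantumManyBody.BoseGas.IsRepulsiveFiniteRange v → (∫⁻ x : Literature.MathematicalPhysics.QuantumManyBody.BoseGas.Space, v ‖x‖) ≠ ⊤ → (∃ C : ℝ, ∀ r, v r ≤ ENNReal.ofReal C) → 0 < Literature.MathematicalPhysics.QuantumManyBody.BoseGas.scatteringLength v → (∃ C ρ₁ : ℝ, 0 < ρ₁ ∧ ∀ ρ : ℝ, 0 < ρ → ρ < ρ₁ → ∀ᶠ N : ℕ in Filter.atTop, Literature.MathematicalPhysics.QuantumManyBody.BoseGas.groundStateEnergy v N (Literature.MathematicalPhysics.QuantumManyBody.BoseGas.sideLength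 ρ N) ≤ ENNReal.ofReal (4 * Real.pi * ρ * (Literature.MathematicalPhysics.QuantumManyBody.BoseGas.scatteringLength v).toReal * (1 + C * Real.sqrt (ρ * (Literature.MathematicalPhysics.QuantumManyBody.BoseGas.scatteringLength v).toReal ^ 3)) * N))

/-- item stmt-AtomisticToContinuum-6595 · crux · rank 3 · closed · moot by None · by planner
why it might fail: needs the mode-resolved Bogoliubov Hessian (keep Σ_shell E_k b†b in BFS/Fournais Thm 2.1) for box states with fluctuating particle number + smooth-shell IMS localisation; constants must close: deficit ≤ V_shell/2 needs slack C_sl√(ρa³)ρaN ≤ K₁√(ρa³)ρaN/4, i.e. K₀ ≳ 4C_sl.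
sources: BrietzkeFournaisSolovej2020, Fournais2020, FournaisSolovej2020, BoccatoEtAl2019Acta, BrenneckeCaporalettiSchlein2022, arXiv:2603.20776
[crux] THE MECHANISM (card steps (2)–(4) merged into one thermodynamic-limit statement; hardest
item): for every v of the class, IF the order-√(ρa³) upper bound of LhyOrderUpperBound holds for v,
THEN there are c, K₀ > 0 such that for every K₁ ≥ K₀ there is ρ₀ > 0 with: for 0 < ρ < ρ₀,
eventually in N, for some δ > 0, every Dirichlet trial state Ψ with energy ≤ E₀ + δ has a finite set
F of box plane waves φ_k = L^{-3/2}e^{2πik·x/L}1_box, all with momenta K₁√(ρa) ≤ |2πk/L| ≤ 2K₁√(ρa)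
(sup norm), whose occupations sum to ≥ (c/K₁)√(ρa³)N. Bogoliubov value: 4√(ρa³)N/K₁ (n_p ≈
(8πρa)²/4p⁴ integrated over the shell), so c ≤ 4; the 1/K₁ law is Tan's k⁻⁴ tail. [deps:
LhyOrderUpperBound] [difficulty: XL] -/
@[route_item "route-AtomisticToContinuum-BECUvDepletionFloor"]
def UvShellFloor : Prop :=
  ∀ v : ℝ → ENNReal, Literature.MathematicalPhysics.QuantumManyBody.BoseGas.IsRepulsiveFiniteRange v → (∫⁻ x : Literature.MathematicalPhysics.QuantumManyBody.BoseGas.Space, v ‖x‖) ≠ ⊤ → (∃ C : ℝ, ∀ r, v r ≤ ENNReal.ofReal C) → 0 < Literature.MathematicalPhysics.QuantumManyBody.BoseGas.scatteringLength v → (∃ C ρ₁ : ℝ, 0 < ρ₁ ∧ ∀ ρ : ℝ, 0 < ρ → ρ < ρ₁ → ∀ᶠ N : ℕ in Filter.atTop, Literature.MathematicalPhysics.QuantumManyBody.BoseGas.groundStateEnergy v N (Literature.MathematicalPhysics.QuantumManyBody.BoseGas.sideLength ρ N) ≤ ENNReal.ofReal (4 * Real.pi * ρ * (Literature.MathematicalPhysics.QuantumManyBody.BoseGas.scatteringLength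 v).toReal * (1 + C * Real.sqrt (ρ * (Literature.MathematicalPhysics.QuantumManyBody.BoseGas.scatteringLength v).toReal ^ 3)) * N)) → ∃ c K₀ : ℝ, 0 < c ∧ 0 < K₀ ∧ ∀ K₁ : ℝ, K₀ ≤ K₁ → ∃ ρ₀ : ℝ, 0 < ρ₀ ∧ ∀ ρ : ℝ, 0 < ρ → ρ < ρ₀ → ∀ᶠ N : ℕ in Filter.atTop, ∃ δ : ENNReal, 0 < δ ∧ ∀ Ψ : Literature.MathematicalPhysics.QuantumManyBody.BoseGas.TrialState N (Literature.MathematicalPhysics.QuantumManyBody.BoseGas.sideLength ρ N), Literature.MathematicalPhysics.QuantumManyBody.BoseGas.energy v Ψ ≤ Literature.MathematicalPhysics.QuantumManyBody.BoseGas.groundStateEnergy v N (Literature.MathematicalPhysics.QuantumManyBody.BoseGas.sideLength ρ N) + δ → ∃ F : Finset (Fin 3 → ℤ), (∀ k ∈ F, K₁ * Real.sqrt (ρ * (Literature.MathematicalPhysics.QuantumManyBody.BoseGas.scatteringLength v).toReal) ≤ 2 * Real.pi / (Literature.MathematicalPhysics.QuantumManyBody.BoseGas.sideLength ρ N) * ‖(fun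 j => ((k : Fin 3 → ℤ) j : ℝ))‖ ∧ 2 * Real.pi / (Literature.MathematicalPhysics.QuantumManyBody.BoseGas.sideLength ρ N) * ‖(fun j => ((k : Fin 3 → ℤ) j : ℝ))‖ ≤ 2 * K₁ * Real.sqrt (ρ * (Literature.MathematicalPhysics.QuantumManyBody.BoseGas.scatteringLength v).toReal)) ∧ ENNReal.ofReal (c / K₁ * Real.sqrt (ρ * (Literature.MathematicalPhysics.QuantumManyBody.BoseGas.scatteringLength v).toReal ^ 3) * N) ≤ ∑ k ∈ F, Literature.MathematicalPhysics.QuantumManyBody.BoseGas.occupation N ((Literature.MathematicalPhysics.QuantumManyBody.BoseGas.box (Literature.MathematicalPhysics.QuantumManyBody.BoseGas.sideLength ρ N)).indicator (fun y : Literature.MathematicalPhysics.QuantumManyBody.BoseGas.Space => ((Real.sqrt ((Literature.MathematicalPhysics.QuantumManyBody.BoseGas.sideLength ρ N) ^ 3))⁻¹ : ℂ) * Complex.exp (Complex.I * (2 * Real.pi / (Literature.MathematicalPhysics.QuantumManyBody.BoseGas.sideLength ρ N) * ∑ j, ((k : Fin 3 → ℤ) j : ℝ) * y j : ℝ)))) 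Ψ.ψ

/-- item stmt-AtomisticToContinuum-6596 · crux · rank 4 · closed · moot by None · by planner
why it might fail: occupation of a hard mode u costs no kinetic energy by itself (n_u picks up |⟨u,φ₀⟩|²N; Dirichlet walls leak O(N^{1/3}) into axis modes) and coherence ACROSS boxes is not box-local: the proof must use the pairing structure (b-variables), i.e. the box coercivity of UvShellFloor.
sources: BoccatoEtAl2019Acta, BrietzkeFournaisSolovej2020, Fournais2020, LSSY2005
[crux] NO ULTRAVIOLET FRAGMENT (energy sees the UV from above, direction by direction): for every v
of the class, IF the order-√(ρa³) upper bound holds for v, THEN there are C, K₀ > 0 such that for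
all K₀ ≤ K₁ < K₂ there is ρ₀ > 0 with: for 0 < ρ < ρ₀, eventually in N, for some δ > 0, every
δ-near-minimiser Ψ, every finite set F of box plane waves with momenta in [K₁√(ρa), K₂√(ρa)] and
every unit coefficient vector α: the occupation of the single mode Σ_k α_k φ_k is ≤ (C/K₁²)√(ρa³)N.
Truth expected far stronger (O(1): γ is diagonal in plane waves for the torus ground state and each
n_p ≤ C); the K₁⁻² law is what the kinetic price p² ≥ K₁²ρa of the shell buys from an order-√(ρa³)
energy slack via n_u ≤ 2 max v_p² + 2 n^b(u). [deps: LhyOrderUpperBound] [difficulty: L] -/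
@[route_item "route-AtomisticToContinuum-BECUvDepletionFloor"]
def NoUvFragment : Prop :=
  ∀ v : ℝ → ENNReal, Literature.MathematicalPhysics.QuantumManyBody.BoseGas.IsRepulsiveFiniteRange v → (∫⁻ x : Literature.MathematicalPhysics.QuantumManyBody.BoseGas.Space, v ‖x‖) ≠ ⊤ → (∃ C : ℝ, ∀ r, v r ≤ ENNReal.ofReal C) → 0 < Literature.MathematicalPhysics.QuantumManyBody.BoseGas.scatteringLength v → (∃ C ρ₁ : ℝ, 0 < ρ₁ ∧ ∀ ρ : ℝ, 0 < ρ → ρ < ρ₁ → ∀ᶠ N : ℕ in Filter.atTop, Literature.MathematicalPhysics.QuantumManyBody.BoseGas.groundStateEnergy v N (Literature.MathematicalPhysics.QuantumManyBody.BoseGas.sideLength ρ N) ≤ ENNReal.ofReal (4 * Real.pi * ρ * (Literature.MathematicalPhysics.QuantumManyBody.BoseGas.scatteringLength v).toReal * (1 + C * Real.sqrt (ρ * (Literature.MathematicalPhysics.QuantumManyBody.BoseGas.scatteringLength v).toReal ^ 3)) * N)) → ∃ C K₀ : ℝ, 0 < C ∧ 0 < K₀ ∧ ∀ K₁ K₂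 : ℝ, K₀ ≤ K₁ → K₁ < K₂ → ∃ ρ₀ : ℝ, 0 < ρ₀ ∧ ∀ ρ : ℝ, 0 < ρ → ρ < ρ₀ → ∀ᶠ N : ℕ in Filter.atTop, ∃ δ : ENNReal, 0 < δ ∧ ∀ Ψ : Literature.MathematicalPhysics.QuantumManyBody.BoseGas.TrialState N (Literature.MathematicalPhysics.QuantumManyBody.BoseGas.sideLength ρ N), Literature.MathematicalPhysics.QuantumManyBody.BoseGas.energy v Ψ ≤ Literature.MathematicalPhysics.QuantumManyBody.BoseGas.groundStateEnergy v N (Literature.MathematicalPhysics.QuantumManyBody.BoseGas.sideLength ρ N) + δ → ∀ (F : Finset (Fin 3 → ℤ)) (α : (Fin 3 → ℤ) → ℂ), (∀ k ∈ F, K₁ * Real.sqrt (ρ * (Literature.MathematicalPhysics.QuantumManyBody.BoseGas.scatteringLength v).toReal) ≤ 2 * Real.pi / (Literature.MathematicalPhysics.QuantumManyBody.BoseGas.sideLength ρ N) * ‖(fun j => ((k : Fin 3 → ℤ) j : ℝ))‖ ∧ 2 * Real.pi / (Literature.MathematicalPhysics.QuantumManyBody.BoseGas.sideLength ρ N) *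 ‖(fun j => ((k : Fin 3 → ℤ) j : ℝ))‖ ≤ K₂ * Real.sqrt (ρ * (Literature.MathematicalPhysics.QuantumManyBody.BoseGas.scatteringLength v).toReal)) → ∑ k ∈ F, ‖α k‖ ^ 2 = 1 → Literature.MathematicalPhysics.QuantumManyBody.BoseGas.occupation N (fun x => ∑ k ∈ F, α k * ((Literature.MathematicalPhysics.QuantumManyBody.BoseGas.box (Literature.MathematicalPhysics.QuantumManyBody.BoseGas.sideLength ρ N)).indicator (fun y : Literature.MathematicalPhysics.QuantumManyBody.BoseGas.Space => ((Real.sqrt ((Literature.MathematicalPhysics.QuantumManyBody.BoseGas.sideLength ρ N) ^ 3))⁻¹ : ℂ) * Complex.exp (Complex.I * (2 * Real.pi / (Literature.MathematicalPhysics.QuantumManyBody.BoseGas.sideLength ρ N) * ∑ j, ((k : Fin 3 → ℤ) j : ℝ) * y j : ℝ)))) x) Ψ.ψ ≤ ENNReal.ofReal (C / K₁ ^ 2 * Real.sqrt (ρ * (Literature.MathematicalPhysics.QuantumManyBody.BoseGas.scatteringLength v).toReal ^ 3) * N)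

/-- item stmt-AtomisticToContinuum-6597 · support · rank 9 · closed · moot by None · by planner
sources: LSSY2005, PenroseOnsager1956
[support] OCCUPATION DICHOTOMY (pure Hilbert-space geometry, provable now): for every N, L, every
Dirichlet trial state Ψ, every finite set F of box plane waves and S, A ∈ [0,∞]: if the occupations
of the φ_k, k ∈ F, sum to ≥ S and every unit combination Σ α_k φ_k has occupation ≤ A, then
maxOccupation N Ψ.ψ + S ≤ N + A. Proof: q(φ) = occupation is N∫dY|⟨φ,Ψ(·,Y)⟩|², so √q is a seminorm;
split a unit φ = φ_S + φ_⊥ along span F; q(φ_S) ≤ ‖φ_S‖²A (homogeneity); Bessel for the orthonormal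
family F ∪ {φ_⊥/‖φ_⊥‖} integrated over Y gives q(φ_⊥) ≤ ‖φ_⊥‖²(N − S); Cauchy–Schwarz
(√(tA)+√((1−t)B))² ≤ A + B. Needs orthonormality of distinct box plane waves (∫₀ᴸ e^{2πimx/L}dx = 0,
m ≠ 0) and the L ≤ 0 / N = 0 degenerate cases (TrialState empty / everything 0). [difficulty:
provable-now] -/
@[route_item "route-AtomisticToContinuum-BECUvDepletionFloor"]
def PlaneWaveDichotomy : Prop :=
  ∀ (N : ℕ) (L : ℝ) (Ψ : Literature.MathematicalPhysics.QuantumManyBody.BoseGas.TrialState N L) (F : Finset (Fin 3 → ℤ)) (S A : ENNReal), S ≤ ∑ k ∈ F, Literature.MathematicalPhysics.QuantumManyBody.BoseGas.occupation N ((Literature.MathematicalPhysics.QuantumManyBody.BoseGas.box (L)).indicator (fun y : Literature.MathematicalPhysics.QuantumManyBody.BoseGas.Space => ((Real.sqrt ((L) ^ 3))⁻¹ : ℂ) * Complex.exp (Complex.I * (2 * Real.pi / (L) * ∑ j, ((k : Fin 3 → ℤ) j : ℝ) * y j : ℝ)))) Ψ.ψ → (∀ α : (Fin 3 → ℤ)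 → ℂ, ∑ k ∈ F, ‖α k‖ ^ 2 = 1 → Literature.MathematicalPhysics.QuantumManyBody.BoseGas.occupation N (fun x => ∑ k ∈ F, α k * ((Literature.MathematicalPhysics.QuantumManyBody.BoseGas.box (L)).indicator (fun y : Literature.MathematicalPhysics.QuantumManyBody.BoseGas.Space => ((Real.sqrt ((L) ^ 3))⁻¹ : ℂ) * Complex.exp (Complex.I * (2 * Real.pi / (L) * ∑ j, ((k : Fin 3 → ℤ) j : ℝ) * y j : ℝ)))) x) Ψ.ψ ≤ A) → Literature.MathematicalPhysics.QuantumManyBody.BoseGas.maxOccupation N Ψ.ψ + S ≤ (N : ENNReal) + A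

/-- item stmt-AtomisticToContinuum-6598 · support · rank 9 · closed · moot by None · by planner
sources: LSSY2005
[support] NEAR-MINIMISERS BOUND THE CONDENSATE NUMBER FROM ABOVE (mirror of the library lemma
le_condensateNumber, provable now): for all v, N, L, δ₀ > 0, m, b: if E₀(N,L) ≠ ⊤ and every trial
state with energy ≤ E₀ + δ₀ has maxOccupation + b ≤ m, then condensateNumber v N L + b ≤ m. Proof:
for each δ > 0 pick, by iInf_lt_iff with min δ δ₀ > 0 and E₀ ≠ ⊤, a trial state below E₀ + min δ δ₀;
iInf₂_le, then ENNReal.iSup_add over the nonempty index δ > 0. [difficulty: provable-now] -/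
@[route_item "route-AtomisticToContinuum-BECUvDepletionFloor"]
def NearMinUpperBound : Prop :=
  ∀ (v : ℝ → ENNReal) (N : ℕ) (L : ℝ) (δ₀ m b : ENNReal), 0 < δ₀ → Literature.MathematicalPhysics.QuantumManyBody.BoseGas.groundStateEnergy v N L ≠ ⊤ → (∀ Ψ : Literature.MathematicalPhysics.QuantumManyBody.BoseGas.TrialState N L, Literature.MathematicalPhysics.QuantumManyBody.BoseGas.energy v Ψ ≤ Literature.MathematicalPhysics.QuantumManyBody.BoseGas.groundStateEnergy v N L + δ₀ → Literature.MathematicalPhysics.QuantumManyBody.BoseGas.maxOccupation N Ψ.ψ + b ≤ m) → Literature.MathematicalPhysics.QuantumManyBody.BoseGas.condensateNumber v N L + b ≤ m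

/-- item stmt-AtomisticToContinuum-6599 · assembly · rank 1 · closed · moot by None · by planner
sources: LSSY2005, Fournais2020
[assembly] LhyOrderUpperBound → UvShellFloor → NoUvFragment → PlaneWaveDichotomy → NearMinUpperBound
→ DepletionFloor. -/
@[route_item "route-AtomisticToContinuum-BECUvDepletionFloor"]
def Assembly : Prop :=
  LhyOrderUpperBound → UvShellFloor → NoUvFragment → PlaneWaveDichotomy → NearMinUpperBound → DepletionFloor

end Summit.AtomisticToContinuum.BoseEinsteinCondensation.Theses.BECUvDepletionFloor
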